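import Summits.QuantumFields.BalabanUV.Beta.GAN24.WoodburyFibreZeroModeOscComp
import Summits.QuantumFields.BalabanUV.Beta.GAN24.FineReadoutGradientDecay

/-!
# GAN24 / WoodburyFibreZeroModeMinimiserLeg — the zero-mode gain CASHED on the canonical soft leg: the COMPOSITE MINIMISER of level `n`
# (the `ℋ`-block `blockFM (KInv (Lc^(n+1)))`, decimated to the step-`m` lattice by an2's `dec (Lc^m)`) meets the engine's forward-difference
# hypothesis UNCONDITIONALLY — from road P1's (N1′) `FineReadoutGradientDecay.exists_wH_grad_decay` BY NAME — with `ε_m ∝ Lc^m·(Lc^(n+1))^{−(d+3)}` at rate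
# `κ₀/((d+1)·Lc^(n+1−m))`, hence `Γ_m^{ff} ∘ (that leg)` has `Decays` constant `∝ C_Γ·Lc^m·(Lc^(n+1))^{−(d+3)}`: the factor `θ^{n+1−m} = Lc^{−(n+1−m)}` against the
# leg's natural size `(Lc^(n+1))^{−(d+2)}` (census row V14 of `HOME/b2b-balaban-gan24-p3/WOODBURY-FIBRE.md` v8.3; binder row G-an2-4 ∕ (CONV-C), P3, gen 8)

Cell `pub-balaban`, β sub-cell.  HONEST FRAMING (verbatim): discharging `BetaPertH` makes Bałaban's UV stability UNCONDITIONAL — a real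
constructive-QFT result; it is NOT the continuum limit and NOT the Clay problem.  HONEST DEPENDENCY (verbatim): continuum YM on T⁴ ⇐
BetaPertH ∧ nine spine estimates (0/9 proved); BetaPertH ⇐ (D1) ∧ (D4) ∧ CAP+tail; G-an2-4 gates asym, D1 and NE2/3/4.  NOT IN PRINT; OUR PROOF
(of [folklore] bookkeeping) over road P1's UNCONDITIONAL theorem (N1′) (`exists_wH_grad_decay`, G-an2-4 swarm leaf-16∕-19∕-09, every `d`, every `Lc`),
an2's `KInv`∕`dec`∕`decays_KInv`∕`decays_dec`, `KernelSpecInstance.l1_le_l1_quo`, `B4ContourShift.abs_le_supNorm`, and this lineage's V14 engine BY NAME;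
cites nothing, mints no `def … : Prop`, instantiates no wall binder.  The `Decays` datum `(C_Γ, δ_Γ)` of the step-`m` block is a HYPOTHESIS (road P1's
unit-normalised `FibreStrip.unitDecayK_holds` is where a `j`-uniform one lives).  Discharges NOTHING of (CONV-C), the W-slot (hW, hWall), «T2Shape», (D1):
whether∕where the composite-minimiser leg IS the leg adjacent to `Γ_m^{ff}` in the class-(c) terms of `K3OfK`∕`W2OfK` is the W∕T₂ skeleton's (Q1)∕(Q2);
NEVER «G-an2-4 closed»; NOT BetaPertH, NOT continuum, NOT Clay.

## Contents (all [folklore]; `D = d+1`, `N = Lc^(n+1)`, `M = Lc^m`)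
* §1 **`exp_supNorm_quo_le`**: `e^{−κ₀‖quo_N w‖∞} ≤ e^{κ₀}·e^{−(κ₀/((d+1)N))·|w|₁}` (block-scale sup-norm decay ⇒ fine `ℓ¹` decay).
* §2 **`fwdDiff_blockFM_KInv_of_grad`**: a gradient bound `|wH κ l (z + e_ν) − wH κ l z| ≤ a·e^{−κ₀‖quo_N z‖∞}` on an2's minimiser column gives the engine's
  hypothesis for the `ℋ`-block: `|blockFM (KInv N) (y + e_μ) z f b − blockFM (KInv N) y z f b| ≤ (a·e^{κ₀})·e^{−(κ₀/((d+1)N))·|y−z|₁}`.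
* §3 **`exists_fwdDiff_blockFM_KInv`** (UNCONDITIONAL, every `d`, `Lc`): `∃ κ₀ C′ > 0 … ∀ n μ y z f b`, the above with `a = C′·((Lc^(n+1))^{d+3})⁻¹` ← (N1′).
* §4 **`exists_fwdDiff_dec_blockFM_KInv`**: on the step-`m` lattice (`m ≤ n + 1`), `|dec (Lc^m) (blockFM (KInv (Lc^(n+1)))) (x′+e_μ) y′ − …| ≤ ε_m·e^{−δ_m|x′−y′|₁}`,
  `ε_m = C″·Lc^m·((Lc^(n+1))^{d+3})⁻¹`, `δ_m = κ₀·Lc^m/((d+1)·Lc^(n+1))`, ONE `(κ₀, C″)` for all `n, m` (`WoodburyFibreZeroModeDec.fwdDiff_dec_row'` + `Lc^m ≤ Lc^(n+1)`).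
* §5 **`exists_gain_minimiserLeg`**: for every `Decays` datum `(C_Γ, δ_Γ)`, `δ_Γ > 0`, of `blockFF (unitK sf sm (KInvStep Lc m))` and every `0 ≤ δ′ ≤ δ_m`, `δ′ < δ_Γ`:
  `Decays (Γ ∘ dec (Lc^m) (blockFM (KInv (Lc^(n+1))))) (|Fib d|·(C_Γ·((d+2)(Lc−1)·ε_m·e^{2δ_m(d+2)(Lc−1)}))·Zl(δ_Γ − δ′)) δ′` (two-rate engine
  `decays_comp_of_annihil_right₂` + `decays_sub_contourRef`; boundedness of the leg from an2's `decays_KInv` + `decays_dec`).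
READING: against the leg's natural size `(Lc^(n+1))^{−(d+2)}` ((N1)) the constant carries `Lc^m/Lc^(n+1) = θ^{n+1−m}`; `e^{2δ_m(d+2)(Lc−1)} ≤ e^{2κ₀(d+2)/(d+1)·…}` is `O(1)`
since `δ_m ≤ κ₀/(d+1)`.  NOT (CONV-C), NOT «W-slot closed», NEVER «G-an2-4 closed», NOT BetaPertH, NOT continuum, NOT Clay.
-/

noncomputable section

open Finset
open scoped BigOperators
open Literature.Probability.LatticeModels (TorusSite Torus.proj)
open Literature.MathematicalPhysics.QuantumFieldTheory
open Literature.MathematicalPhysics.QuantumFieldTheory.Balaban1983to89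
open Literature.MathematicalPhysics.QuantumFieldTheory.Balaban1983to89.Beta
open B12Sec2to5 (l1 l1_nonneg)
open ExpKernelCalculus (MKer Decays comp Zl)
open KernelWard (Bdd bdd_of_decays)
open Summit.QuantumFields.BalabanUV.Beta.TameKernelCalculus (Spr)
open AffineAveraging (unitVec)
open LatticeForm (quo)
open B4ContourShift (supNorm supNorm_nonneg abs_le_supNorm)
open KernelSpecInstance (wH l1_le_l1_quo)
open OneStepResolventKernel (Fib KInv decays_KInv decays_mono)
open OneStepKernelFamily (dec KInvStep decays_dec)
open Summit.QuantumFields.BalabanUV.Beta.HessKerDressedUnits (unitK)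
open Summit.QuantumFields.BalabanUV.Beta.GAN24.WoodburyFibreBlocks (blockFF blockFM)
open Summit.QuantumFields.BalabanUV.Beta.GAN24.WoodburyFibreZeroModeGain
open Summit.QuantumFields.BalabanUV.Beta.GAN24.WoodburyFibreZeroModeGainKInv
open Summit.QuantumFields.BalabanUV.Beta.GAN24.WoodburyFibreZeroModeOsc
open Summit.QuantumFields.BalabanUV.Beta.GAN24.WoodburyFibreZeroModeGainUnits
open Summit.QuantumFields.BalabanUV.Beta.GAN24.WoodburyFibreZeroModeDec (fwdDiff_dec_row')
open Summit.QuantumFields.BalabanUV.Beta.GAN24.WoodburyFibreZeroModeGainTwoRate (decays_comp_of_annihil_right₂)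
open Summit.QuantumFields.BalabanUV.Beta.GAN24.FineReadoutGradientDecay (exists_wH_grad_decay)

namespace Summit.QuantumFields.BalabanUV.Beta.GAN24.WoodburyFibreZeroModeMinimiserLeg

variable {d : ℕ}

/-! ## §1 Block-scale sup-norm decay ⇒ fine `ℓ¹` decay -/

/-- **BLOCK-SCALE SUP-NORM DECAY ⇒ FINE `ℓ¹` DECAY**: `e^{−κ₀‖quo_N w‖∞} ≤ e^{κ₀}·e^{−(κ₀/((d+1)N))·|w|₁}` (`κ₀ ≥ 0`). [folklore] -/
theorem exp_supNorm_quo_le {N : ℕ} [NeZero N] {κ₀ : ℝ} (hκ : 0 ≤ κ₀) (w : Fin (d + 1) → ℤ) :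
    Real.exp (-(κ₀ * supNorm (quo N w))) ≤ Real.exp κ₀ * Real.exp (-(κ₀ / (((d : ℝ) + 1) * N)) * l1 w) := by
  have hN : (0 : ℝ) < N := by exact_mod_cast Nat.pos_of_ne_zero (NeZero.ne N)
  have hD : (0 : ℝ) < (d : ℝ) + 1 := by positivity
  rw [← Real.exp_add, Real.exp_le_exp]
  have h1 := l1_le_l1_quo (N := N) (d := d) w
  -- `|quo N w|₁ ≤ (d+1)·‖quo N w‖∞` (the tree's `T4GaugeActionRatePair.l1_le_mul_supNorm`, inlined to keep the import cone small)
  have h2 : l1 (quo N w) ≤ ((d : ℝ) + 1) * supNorm (quo N w) := by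
    calc l1 (quo N w) = ∑ i, |((quo N w) i : ℝ)| := rfl
      _ ≤ ∑ _i : Fin (d + 1), supNorm (quo N w) := Finset.sum_le_sum fun i _ => by
          have h := abs_le_supNorm (quo N w) i
          rwa [Int.cast_abs] at h
      _ = ((d : ℝ) + 1) * supNorm (quo N w) := by
          rw [Finset.sum_const, Finset.card_univ, Fintype.card_fin, nsmul_eq_mul]; push_cast; ring
  -- `l1 w ≤ N·(d+1)·supNorm (quo N w) + N·(d+1)`
  have h3 : l1 w ≤ (N : ℝ) * (((d : ℝ) + 1) * supNorm (quo N w)) + (N : ℝ) * (d + 1) := by nlinarith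
  have h4 : κ₀ / (((d : ℝ) + 1) * N) * l1 w ≤ κ₀ * supNorm (quo N w) + κ₀ := by
    have hDN : (0 : ℝ) < ((d : ℝ) + 1) * N := by positivity
    calc κ₀ / (((d : ℝ) + 1) * N) * l1 w ≤ κ₀ / (((d : ℝ) + 1) * N) * ((N : ℝ) * (((d : ℝ) + 1) * supNorm (quo N w)) + (N : ℝ) * (d + 1)) :=
          mul_le_mul_of_nonneg_left h3 (div_nonneg hκ hDN.le)
      _ = κ₀ * supNorm (quo N w) + κ₀ := by field_simp
  linarith

/-! ## §2 The `ℋ`-block of an2's packed resolvent meets the engine's hypothesis, given a gradient bound on `wH` -/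

section HBlock

variable {N : ℕ} [NeZero N]

/-- The `ℋ`-block entries of `KInv`: `wH κ l (y − z)` on the coarse sublattice in `z`, `0` off it; all other blocks of `blockFM` vanish. [folklore] -/
theorem blockFM_KInv_apply (y z : Fin (d + 1) → ℤ) (f b : Fib d) :
    blockFM (KInv (N := N) (d := d)) y z f b =
      match f, b with
      | Sum.inl κ, Sum.inr l => if Torus.proj N z = 0 then wH (N := N) κ l (y - z) else 0
      | _, _ => 0 := by
  rcases f with κ | κ <;> rcases b with l | l <;> rfl

/-- **THE `ℋ`-BLOCK MEETS THE HYPOTHESIS**: a gradient bound `|wH κ l (z + e_ν) − wH κ l z| ≤ a·e^{−κ₀‖quo_N z‖∞}` (all κ l z ν; `a, κ₀ ≥ 0`) gives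
`|blockFM (KInv N) (y + e_μ) z f b − blockFM (KInv N) y z f b| ≤ (a·e^{κ₀})·e^{−(κ₀/((d+1)N))·|y − z|₁}`. [folklore] -/
theorem fwdDiff_blockFM_KInv_of_grad {a κ₀ : ℝ} (ha : 0 ≤ a) (hκ : 0 ≤ κ₀)
    (hg : ∀ (κ l : Fin (d + 1)) (z : Fin (d + 1) → ℤ) (ν : Fin (d + 1)),
      |wH (N := N) κ l (z + unitVec ν) - wH (N := N) κ l z| ≤ a * Real.exp (-(κ₀ * supNorm (quo N z))))
    (μ : Fin (d + 1)) (y z : Fin (d + 1) → ℤ) (f b : Fib d) :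
    |blockFM (KInv (N := N) (d := d)) (y + unitVec μ) z f b - blockFM (KInv (N := N) (d := d)) y z f b|
      ≤ (a * Real.exp κ₀) * Real.exp (-(κ₀ / (((d : ℝ) + 1) * N)) * l1 (y - z)) := by
  have hRHS : 0 ≤ (a * Real.exp κ₀) * Real.exp (-(κ₀ / (((d : ℝ) + 1) * N)) * l1 (y - z)) := by positivity
  rcases f with κ | κ <;> rcases b with l | l
  · simp only [blockFM, sub_self, abs_zero]; exact hRHS
  · simp only [blockFM, KInv]
    by_cases hz : Torus.proj N z = 0
    · simp only [hz, if_true]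
      have e : y + unitVec μ - z = (y - z) + unitVec μ := by abel
      rw [e]
      refine (hg κ l (y - z) μ).trans ?_
      rw [mul_assoc]
      exact mul_le_mul_of_nonneg_left (exp_supNorm_quo_le hκ (y - z)) ha
    · simp only [hz, if_false, sub_self, abs_zero]; exact hRHS
  · simp only [blockFM, sub_self, abs_zero]; exact hRHS
  · simp only [blockFM, sub_self, abs_zero]; exact hRHS

end HBlock

/-! ## §3 Unconditionally, from road P1's (N1′) -/

section Levels

variable {Lc : ℕ} [NeZero Lc]

/-- **UNCONDITIONAL FINE FORWARD-DIFFERENCE BOUND OF THE COMPOSITE MINIMISER BLOCK** (every `d`, every `Lc`, all levels `N = Lc^(n+1)`, ONE `(κ₀, C)`):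
`|blockFM (KInv (Lc^(n+1))) (y + e_μ) z f b − …| ≤ C·((Lc^(n+1))^{d+3})⁻¹·e^{−(κ₀/((d+1)Lc^(n+1)))·|y−z|₁}` — (N1′) BY NAME through §2. [folklore] -/
theorem exists_fwdDiff_blockFM_KInv :
    ∃ κ₀ C : ℝ, 0 < κ₀ ∧ 0 ≤ C ∧ ∀ (n : ℕ) (μ : Fin (d + 1)) (y z : Fin (d + 1) → ℤ) (f b : Fib d),
      |blockFM (KInv (N := Lc ^ (n + 1)) (d := d)) (y + unitVec μ) z f b - blockFM (KInv (N := Lc ^ (n + 1)) (d := d)) y z f b|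
        ≤ (C * (((Lc ^ (n + 1) : ℕ) : ℝ) ^ (d + 3))⁻¹) * Real.exp (-(κ₀ / (((d : ℝ) + 1) * ((Lc ^ (n + 1) : ℕ) : ℝ))) * l1 (y - z)) := by
  obtain ⟨κ₀, C', hκ₀, hC', h⟩ := exists_wH_grad_decay (d := d) (Lc := Lc)
  refine ⟨κ₀, C' * Real.exp κ₀, hκ₀, by positivity, fun n μ y z f b => ?_⟩
  have hg : ∀ (κ l : Fin (d + 1)) (w : Fin (d + 1) → ℤ) (ν : Fin (d + 1)),
      |wH (N := Lc ^ (n + 1)) κ l (w + unitVec ν) - wH (N := Lc ^ (n + 1)) κ l w|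
        ≤ (C' * (((Lc ^ (n + 1) : ℕ) : ℝ) ^ (d + 3))⁻¹) * Real.exp (-(κ₀ * supNorm (quo (Lc ^ (n + 1)) w))) := by
    intro κ l w ν
    have := h n κ l w ν
    simpa only [AffineAveraging.unitVec] using this
  have hb := fwdDiff_blockFM_KInv_of_grad (N := Lc ^ (n + 1)) (by positivity) hκ₀.le hg μ y z f b
  refine hb.trans (le_of_eq ?_)
  ring

/-! ## §4 On the step-`m` lattice: the decimated composite-minimiser leg -/

/-- `Lc^m ≤ Lc^(n+1)` as reals for `m ≤ n + 1`. [folklore] -/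
theorem pow_le_pow_cast {m n : ℕ} (hm : m ≤ n + 1) : ((Lc ^ m : ℕ) : ℝ) ≤ ((Lc ^ (n + 1) : ℕ) : ℝ) := by
  exact_mod_cast Nat.pow_le_pow_right (Nat.pos_of_ne_zero (NeZero.ne Lc)) hm

/-- **UNCONDITIONAL STEP-`m` FORWARD-DIFFERENCE BOUND OF THE DECIMATED COMPOSITE-MINIMISER LEG** (ONE `(κ₀, C)` for all `n`, `m ≤ n + 1`):
`|dec (Lc^m) (blockFM (KInv (Lc^(n+1)))) (x′ + e_μ) y′ a b − …| ≤ (C·Lc^m·((Lc^(n+1))^{d+3})⁻¹)·e^{−(κ₀·Lc^m/((d+1)·Lc^(n+1)))·|x′−y′|₁}` — the factor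
`Lc^m/Lc^(n+1) = θ^{n+1−m}` against the leg's natural size. [folklore] -/
theorem exists_fwdDiff_dec_blockFM_KInv :
    ∃ κ₀ C : ℝ, 0 < κ₀ ∧ 0 ≤ C ∧ ∀ (n m : ℕ), m ≤ n + 1 → ∀ (μ : Fin (d + 1)) (x' y' : Fin (d + 1) → ℤ) (a b : Fib d),
      |dec (Lc ^ m) (blockFM (KInv (N := Lc ^ (n + 1)) (d := d))) (x' + unitVec μ) y' a b
          - dec (Lc ^ m) (blockFM (KInv (N := Lc ^ (n + 1)) (d := d))) x' y' a b|
        ≤ (C * ((Lc ^ m : ℕ) : ℝ) * (((Lc ^ (n + 1) : ℕ) : ℝ) ^ (d + 3))⁻¹) *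
            Real.exp (-((κ₀ / (((d : ℝ) + 1) * ((Lc ^ (n + 1) : ℕ) : ℝ))) * ((Lc ^ m : ℕ) : ℝ)) * l1 (x' - y')) := by
  obtain ⟨κ₀, C, hκ₀, hC, h⟩ := exists_fwdDiff_blockFM_KInv (d := d) (Lc := Lc)
  refine ⟨κ₀, C * Real.exp (κ₀ * (4 * d + 5) / ((d : ℝ) + 1)), hκ₀, by positivity, fun n m hm μ x' y' a b => ?_⟩
  set N : ℝ := ((Lc ^ (n + 1) : ℕ) : ℝ) with hNdef
  set M : ℝ := ((Lc ^ m : ℕ) : ℝ) with hMdef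
  have hN : 0 < N := by rw [hNdef]; exact_mod_cast pow_pos (Nat.pos_of_ne_zero (NeZero.ne Lc)) _
  have hM1 : 1 ≤ Lc ^ m := Nat.one_le_pow _ _ (Nat.pos_of_ne_zero (NeZero.ne Lc))
  have hMN : M ≤ N := pow_le_pow_cast (Lc := Lc) hm
  have hD : (0 : ℝ) < (d : ℝ) + 1 := by positivity
  have hδ : 0 ≤ κ₀ / (((d : ℝ) + 1) * N) := div_nonneg hκ₀.le (by positivity)
  have hb := fwdDiff_dec_row' (K := blockFM (KInv (N := Lc ^ (n + 1)) (d := d))) (ε := C * (N ^ (d + 3))⁻¹)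
    (δ := κ₀ / (((d : ℝ) + 1) * N)) (by positivity) hδ (fun μ p q a b => h n μ p q a b) hM1 μ x' y' a b
  refine hb.trans ?_
  -- the exponential prefactor `e^{δ M (4d+5)} ≤ e^{κ₀(4d+5)/(d+1)}` since `M ≤ N`
  have hexp : Real.exp (κ₀ / (((d : ℝ) + 1) * N) * (M * (4 * d + 5))) ≤ Real.exp (κ₀ * (4 * d + 5) / ((d : ℝ) + 1)) := by
    rw [Real.exp_le_exp]
    rw [show κ₀ / (((d : ℝ) + 1) * N) * (M * (4 * d + 5)) = (κ₀ * (4 * d + 5) / ((d : ℝ) + 1)) * (M / N) by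
      field_simp]
    have hq : M / N ≤ 1 := (div_le_one hN).mpr hMN
    have hpos : 0 ≤ κ₀ * (4 * d + 5) / ((d : ℝ) + 1) := by positivity
    nlinarith
  have hE : 0 ≤ Real.exp (-(κ₀ / (((d : ℝ) + 1) * N) * M) * l1 (x' - y')) := (Real.exp_pos _).le
  calc M * (C * (N ^ (d + 3))⁻¹) * Real.exp (κ₀ / (((d : ℝ) + 1) * N) * (M * (4 * d + 5))) *
        Real.exp (-(κ₀ / (((d : ℝ) + 1) * N) * M) * l1 (x' - y'))
      ≤ M * (C * (N ^ (d + 3))⁻¹) * Real.exp (κ₀ * (4 * d + 5) / ((d : ℝ) + 1)) *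
        Real.exp (-(κ₀ / (((d : ℝ) + 1) * N) * M) * l1 (x' - y')) := by
        refine mul_le_mul_of_nonneg_right (mul_le_mul_of_nonneg_left hexp (by positivity)) hE
    _ = C * Real.exp (κ₀ * (4 * d + 5) / ((d : ℝ) + 1)) * M * (N ^ (d + 3))⁻¹ *
        Real.exp (-(κ₀ / (((d : ℝ) + 1) * N) * M) * l1 (x' - y')) := by ring

/-! ## §5 The gain for `Γ_m^{ff} ∘ (decimated composite-minimiser leg)` -/

/-- The decimated `ℋ`-block leg is bounded (qualitatively, from an2's per-`N` decay of `KInv` and the decimation). [folklore] -/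
theorem exists_bdd_dec_blockFM_KInv (n m : ℕ) :
    ∃ B : ℝ, Bdd (dec (Lc ^ m) (blockFM (KInv (N := Lc ^ (n + 1)) (d := d)))) B := by
  obtain ⟨δ, C, hδ, hC, hK⟩ := decays_KInv (N := Lc ^ (n + 1)) (d := d)
  have hFM : Decays (blockFM (KInv (N := Lc ^ (n + 1)) (d := d))) C δ := by
    intro x y a b
    have h0 : 0 ≤ C * Real.exp (-δ * l1 (x - y)) := (abs_nonneg _).trans (hK x y a b)
    rcases a with κ | κ <;> rcases b with l | l
    · simpa [blockFM] using h0
    · exact hK x y (Sum.inl κ) (Sum.inr l)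
    all_goals simpa [blockFM] using h0
  have hM1 : 1 ≤ Lc ^ m := Nat.one_le_pow _ _ (Nat.pos_of_ne_zero (NeZero.ne Lc))
  exact ⟨_, bdd_of_decays (decays_dec hFM hC hδ.le hM1) hδ.le⟩

/-- **THE GAIN, CASHED ON THE CANONICAL SOFT LEG** (every `d`, every `Lc`; ONE `(κ₀, C)` for all `n`, `m ≤ n + 1`, all units `sf sm`, every `Decays` datum
`(C_Γ, δ_Γ > 0)` of the step-`m` block `Γ := blockFF (unitK sf sm (KInvStep Lc m))`, every `0 ≤ δ′ ≤ δ_m`, `δ′ < δ_Γ`, `δ_m = κ₀·Lc^m/((d+1)·Lc^(n+1))`):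
`Decays (Γ ∘ dec (Lc^m) (blockFM (KInv (Lc^(n+1))))) (|Fib d|·(C_Γ·ω)·Zl_{d+1}(δ_Γ − δ′)) δ′` with
`ω = (d+2)(Lc−1)·(C·Lc^m·((Lc^(n+1))^{d+3})⁻¹)·e^{2δ_m(d+2)(Lc−1)}`. [folklore] -/
theorem exists_gain_minimiserLeg :
    ∃ κ₀ C : ℝ, 0 < κ₀ ∧ 0 ≤ C ∧ ∀ (n m : ℕ), m ≤ n + 1 → ∀ (sf sm CΓ δΓ δ' : ℝ),
      Decays (blockFF (unitK sf sm (KInvStep (d := d) Lc m))) CΓ δΓ → 0 < δΓ → 0 ≤ δ' →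
      δ' ≤ (κ₀ / (((d : ℝ) + 1) * ((Lc ^ (n + 1) : ℕ) : ℝ))) * ((Lc ^ m : ℕ) : ℝ) → δ' < δΓ →
      Decays (comp (blockFF (unitK sf sm (KInvStep (d := d) Lc m))) (dec (Lc ^ m) (blockFM (KInv (N := Lc ^ (n + 1)) (d := d)))))
        ((Fintype.card (Fib d) : ℝ) *
          (CΓ * ((((d : ℝ) + 2) * ((Lc : ℝ) - 1)) * (C * ((Lc ^ m : ℕ) : ℝ) * (((Lc ^ (n + 1) : ℕ) : ℝ) ^ (d + 3))⁻¹) *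
            Real.exp (2 * ((κ₀ / (((d : ℝ) + 1) * ((Lc ^ (n + 1) : ℕ) : ℝ))) * ((Lc ^ m : ℕ) : ℝ)) * (((d : ℝ) + 2) * ((Lc : ℝ) - 1))))) *
          Zl (d + 1) (δΓ - δ')) δ' := by
  obtain ⟨κ₀, C, hκ₀, hC, h⟩ := exists_fwdDiff_dec_blockFM_KInv (d := d) (Lc := Lc)
  refine ⟨κ₀, C, hκ₀, hC, fun n m hm sf sm CΓ δΓ δ' hΓ hδΓ hδ'0 hδ'J hδ'Γ => ?_⟩
  have hΓs : Spr (blockFF (unitK sf sm (KInvStep (d := d) Lc m))) := ⟨CΓ, δΓ, hδΓ, hΓ⟩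
  obtain ⟨B, hB⟩ := exists_bdd_dec_blockFM_KInv (d := d) (Lc := Lc) n m
  have hδm : 0 ≤ (κ₀ / (((d : ℝ) + 1) * ((Lc ^ (n + 1) : ℕ) : ℝ))) * ((Lc ^ m : ℕ) : ℝ) := by positivity
  have hε : 0 ≤ C * ((Lc ^ m : ℕ) : ℝ) * (((Lc ^ (n + 1) : ℕ) : ℝ) ^ (d + 3))⁻¹ := by positivity
  exact decays_comp_of_annihil_right₂ hΓs.tame.1 hB (bdd_contourRef hB)
    (comp_contourRef_eq_zero hΓs.tame.1 hB (fun x y a κ => blockFF_inr_right _ x y a κ)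
      (fun x a κ u => contourSum_blockFF_unitKInvStep_right sf sm m x a κ u))
    hΓ (decays_sub_contourRef (N := Lc) hε hδm (fun μ y z f b => h n m hm μ y z f b)) hδ'0 hδ'J hδ'Γ

end Levels

end Summit.QuantumFields.BalabanUV.Beta.GAN24.WoodburyFibreZeroModeMinimiserLeg

end
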